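import Mathlib
import Summits.KontsevichZagierPeriods.Zeta5Search.RVPeriodicShiftCasLB
import Summits.KontsevichZagierPeriods.Zeta5Search.LemmaDBonusProof
import HarnessLib

/-!
# ζ(5) search — the `y = 0` BOUNDARY FAMILY on the ray C1 (`p ∣ n`): class data and the bound `−6 − 256m` for every `m` (fam-rv g17, PROOFS)

HONEST FRAMING: systematic search; no irrationality claim unless certified.  Pure combinatorics / valuations of rationals along the
explicit ray `b(n) = n·(85; 35,32,30,27,25,22,20)`; nothing about `ζ(5)`; every exponent this could ever feed is `< 1`.

OUR work (Summit side; family-designer seat `fam-rv`, generation 17; tree imports only).  The periodic cells of the `θ ≤ 1` producer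
(fam-denom's route (A), and our `PWin` windows) are parametrised by `y = n/p − m ∈ (0, 1)`; the only reachable BOUNDARY is `y = 0`,
i.e. `p ∣ n`, `n = m·p` (`θ = 1/m`).  There the class data are uniform in `p` AND `m` and we compute them outright from the residue
counts of `RVPeriodicShift` (`classExp_bC1_counts`, `cnt_add_mul`):
* `cnt p x (c·p) = c`, `cnt p x (c·p + 1) = c + [p ∣ x]` (`cnt_mul`, `cnt_mul_succ`); the centre class is `x ≡ 0` (`centreIn_bC1_mul`);
* **`E_x(b(mp), p) = −128·m − 5·[p ∣ x]`** (`classExp_bC1_mul`): the class of `0` — which contains every block end `β_j·n`, `(85−β_j)·n`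
  and the centre — lies `5` below all other classes; every class has `≥ 40` poles (`classPoleCount_ge`), so `LB(b(mp), p) ≥ −256·m − 7`
  (`casLB_bC1_mul_ge`, via `casLB_bC1_eq`);
* the Lemma-D hypotheses hold with `m_min = −128m − 5` (unique deep class, no single-pole class), so the TREE THEOREM `LemmaDBonus`
  (`lemmaDBonus_holds`) gives **`v_p(Cas₇(b(m·p))) ≥ −256·m − 6` for every `m ≥ 1` and every prime `p ≥ 5` in the window**
  (`r0_bound`, `r0_bound_dvd`) — exactly the bound `B1 − 256·m`, `B1 = −6`, of the adjacent cell `y ∈ (0, 1/85)` (letters `JBI` there; at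
  `y = 0` the letter is `J`: law B and law I are off since `M = 128m + 5` is odd and the deep class is the centre class).
No `sorry`, no new axioms, no `native_decide`.
-/

namespace Summit.KontsevichZagierPeriods.Zeta5Search.RVPeriodic

open Finset
open Summit.KontsevichZagierPeriods.Zeta5Search.RayC1
open Summit.KontsevichZagierPeriods.Zeta5Search.ClusterValuation
open Summit.KontsevichZagierPeriods.Zeta5Search.CasoratianValuation (InPolytope shift casoratian)
open Summit.KontsevichZagierPeriods.Zeta5Search.WedgeDictionary (dOf)

section R0

variable {p : ℕ} [hP : Fact p.Prime]

/-- Residue counts at multiples of `p`: `cnt p x (c·p) = c`. -/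
theorem cnt_mul (x c : ℕ) : cnt p x (c * p) = c := by
  have h := cnt_add_mul p x hP.out.pos 0 c
  rw [zero_add] at h
  rw [h]
  simp [cnt]

omit hP in
/-- `cnt p x 1 = [p ∣ x]`. -/
theorem cnt_one (x : ℕ) : cnt p x 1 = if p ∣ x then 1 else 0 := by
  unfold cnt
  rw [range_one, filter_singleton, Nat.zero_mod]
  by_cases h : p ∣ x
  · rw [if_pos (Nat.eq_zero_of_dvd_of_lt h |> fun _ => (Nat.mod_eq_zero_of_dvd h).symm), if_pos h, card_singleton]
  · have h' : ¬ 0 = x % p := fun e => h (Nat.dvd_of_mod_eq_zero e.symm)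
    rw [if_neg h', if_neg h, card_empty]

/-- Residue counts just past multiples of `p`: `cnt p x (c·p + 1) = c + [p ∣ x]`. -/
theorem cnt_mul_succ (x c : ℕ) : cnt p x (c * p + 1) = c + if p ∣ x then 1 else 0 := by
  rw [show c * p + 1 = 1 + c * p by ring, cnt_add_mul p x hP.out.pos 1 c, cnt_one, add_comm]

/-- On the boundary `n = m·p` the centre class is the class of `0` (`p` odd). -/
theorem centreIn_bC1_mul (hp2 : p ≠ 2) (m x : ℕ) : CentreIn (bC1 (m * p)) p x ↔ p ∣ x := by
  unfold CentreIn
  rw [(bC1_vals (m * p)).1]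
  have e : 2 * (x : ℤ) - 85 * ((m * p : ℕ) : ℤ) = 2 * x + (-(85 * m : ℤ)) * p := by push_cast; ring
  rw [e, dvd_add_left (dvd_mul_left _ _)]
  have hpr := Nat.prime_iff_prime_int.1 hP.out
  constructor
  · intro h
    rcases hpr.dvd_or_dvd h with h2 | h2
    · exfalso
      have h3 : p ∣ 2 := by exact_mod_cast h2
      exact hp2 ((Nat.prime_dvd_prime_iff_eq hP.out Nat.prime_two).1 h3)
    · exact_mod_cast h2
  · intro h
    exact dvd_mul_of_dvd_right (by exact_mod_cast h) 2

/-- The block sum at the boundary: `Σ_j ((85 − β_j)m + δ − β_j m) = 213m + 7δ`. -/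
theorem sum_blocks_mul (m δ : ℕ) :
    (∑ j ∈ range 7, ((((85 - βC1 j) * m + δ : ℕ) : ℤ) - ((βC1 j * m : ℕ) : ℤ))) = 213 * m + 7 * δ := by
  simp [Finset.sum_range_succ, βC1]
  ring

/-- **CLASS EXPONENTS ON THE BOUNDARY `n = m·p`**: `E_x = −128·m − 5·[p ∣ x]` (`p` odd). -/
theorem classExp_bC1_mul (hp2 : p ≠ 2) (m x : ℕ) :
    classExp (bC1 (m * p)) p x = -(128 : ℤ) * m - if p ∣ x then 5 else 0 := by
  rw [classExp_bC1_counts hp2]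
  have e0 : cnt p x (85 * (m * p) + 1) = 85 * m + if p ∣ x then 1 else 0 := by
    rw [show 85 * (m * p) = (85 * m) * p by ring, cnt_mul_succ]
  have e1 : ∀ j ∈ range 7, cnt p x ((85 - βC1 j) * (m * p) + 1) = (85 - βC1 j) * m + if p ∣ x then 1 else 0 := by
    intro j _
    rw [show (85 - βC1 j) * (m * p) = ((85 - βC1 j) * m) * p by ring, cnt_mul_succ]
  have e2 : ∀ j ∈ range 7, cnt p x (βC1 j * (m * p)) = βC1 j * m := by
    intro j _
    rw [show βC1 j * (m * p) = (βC1 j * m) * p by ring, cnt_mul]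
  rw [e0, sum_congr rfl fun j hj => by rw [e1 j hj, e2 j hj]]
  by_cases hx : p ∣ x
  · simp only [if_pos hx, if_pos ((centreIn_bC1_mul hp2 m x).2 hx)]
    rw [sum_blocks_mul m 1]
    push_cast
    ring
  · simp only [if_neg hx, if_neg (fun h => hx ((centreIn_bC1_mul hp2 m x).1 h))]
    rw [sum_blocks_mul m 0]
    push_cast
    ring

/-- **THE CLASS BOUND ON THE BOUNDARY**: `LB(b(mp), p) ≥ −256·m − 7` (`m ≥ 1`; in fact equality). -/
theorem casLB_bC1_mul_ge (hp2 : p ≠ 2) {m : ℕ} (hm : 1 ≤ m) : -(256 : ℤ) * m - 7 ≤ casLB (bC1 (m * p)) p := by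
  have hpn : p ≤ m * p := Nat.le_mul_of_pos_left p hm
  obtain ⟨v, hv⟩ := min?_map_range_isSome hP.out.pos (classExp (bC1 (m * p)) p)
  rw [casLB_bC1_eq (m * p) hpn hv]
  obtain ⟨x, -, hx⟩ := List.mem_map.1 (List.min?_mem hv)
  have : -(128 : ℤ) * m - 5 ≤ v := by
    rw [← hx, classExp_bC1_mul hp2]
    split_ifs <;> linarith
  linarith

/-- **THE `y = 0` BOUNDARY FAMILY, ALL SHIFTS AT ONCE** (given the tree theorem `LemmaDBonus`): for every `m ≥ 1` and every prime `p ≥ 5`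
with `b(m·p)` in the window, `v_p(Cas₇(b(m·p))) ≥ −256·m − 6`. -/
theorem r0_bound_of (hD : LemmaDBonus) (hp5 : 5 ≤ p) {m : ℕ} (hm : 1 ≤ m) (hsq : 85 * (m * p) + 2 < p * p)
    (hne : casoratian (bC1 (m * p)) 7 ≠ 0) : -(256 : ℤ) * m - 6 ≤ padicValRat p (casoratian (bC1 (m * p)) 7) := by
  have hp := hP.out
  have hp2 : p ≠ 2 := by omega
  have hpn : p ≤ m * p := Nat.le_mul_of_pos_left p hm
  have h1n : 1 ≤ m * p := by have := Nat.mul_le_mul hm hp5; omega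
  have hb0 : bC1 (m * p) 0 = 85 * ((m * p : ℕ) : ℤ) := (bC1_vals (m * p)).1
  have hcast : (p : ℤ) ≤ ((m * p : ℕ) : ℤ) := by exact_mod_cast hpn
  have hmul : ∀ x, x ∈ multipoleClasses (bC1 (m * p)) p ↔ x < p := by
    intro x
    unfold multipoleClasses
    rw [mem_filter, mem_range]
    exact ⟨fun h => h.1, fun h => ⟨h, le_trans (by norm_num) (classPoleCount_ge (m * p) x hpn)⟩⟩
  have hsh : shift (bC1 (m * p)) 7 = bC1' (m * p) := by rw [shift, bC1'_eq_update]
  have hv := hD (bC1 (m * p)) 7 p (-(128 : ℤ) * m - 5) (inPolytope_bC1 _) (by norm_num) le_rfl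
    (by rw [hsh]; exact inPolytope_bC1' h1n) hp hp5 (by rw [hb0]; linarith) (by rw [dOf_bC1]; linarith)
    (by
      rw [hb0, sq]
      have : ((85 * (m * p) + 2 : ℕ) : ℤ) < ((p * p : ℕ) : ℤ) := by exact_mod_cast hsq
      push_cast at this ⊢
      linarith)
    ⟨0, (hmul 0).2 hp.pos, by rw [classExp_bC1_mul hp2, if_pos (dvd_zero p)]⟩
    (fun x _ => by rw [classExp_bC1_mul hp2]; split_ifs <;> linarith)
    (fun y _ h1 => by have := classPoleCount_ge (p := p) (m * p) y hpn; omega)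
    (by
      intro x hx y hy hEx hEy _ _
      rw [hmul] at hx hy
      rw [classExp_bC1_mul hp2] at hEx hEy
      have hx0 : p ∣ x := by by_contra h; rw [if_neg h] at hEx; linarith
      have hy0 : p ∣ y := by by_contra h; rw [if_neg h] at hEy; linarith
      have ex : x = 0 := Nat.eq_zero_of_dvd_of_lt hx0 hx
      have ey : y = 0 := Nat.eq_zero_of_dvd_of_lt hy0 hy
      subst ex; subst ey
      unfold sameType
      exact decide_eq_true ⟨Iff.rfl, Or.inl rfl⟩)
    hne
  have hLB := casLB_bC1_mul_ge hp2 hm (p := p)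
  linarith

/-- **THE `y = 0` BOUNDARY FAMILY** (unconditional: `LemmaDBonus` is the tree theorem `lemmaDBonus_holds`): for every `m ≥ 1` and every
prime `p ≥ 5` with `85·m·p + 2 < p²`, `v_p(Cas₇(b(m·p))) ≥ −256·m − 6` — the bound `B1 − 256·m`, `B1 = −6`, of the cell `y ∈ (0, 1/85)`. -/
theorem r0_bound (hp5 : 5 ≤ p) {m : ℕ} (hm : 1 ≤ m) (hsq : 85 * (m * p) + 2 < p * p)
    (hne : casoratian (bC1 (m * p)) 7 ≠ 0) : -(256 : ℤ) * m - 6 ≤ padicValRat p (casoratian (bC1 (m * p)) 7) :=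
  r0_bound_of lemmaDBonus_holds hp5 hm hsq hne

end R0

/-- **THE `y = 0` BOUNDARY FAMILY in consumer shape** (`p ∣ n`; the shift index is `n / p`): for every prime `p ≥ 5` and every `n` with
`p ∣ n`, `85n + 2 < p²`, `v_p(Cas₇(b(n))) ≥ −6 − 256·(n/p)`. -/
theorem r0_bound_dvd {n p : ℕ} (hp : p.Prime) (hp5 : 5 ≤ p) (hpn : p ∣ n) (hn : 1 ≤ n) (hsq : 85 * n + 2 < p * p)
    (hne : casoratian (bC1 n) 7 ≠ 0) : -(6 : ℤ) - 256 * ((n / p : ℕ) : ℤ) ≤ padicValRat p (casoratian (bC1 n) 7) := by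
  haveI : Fact p.Prime := ⟨hp⟩
  obtain ⟨m, rfl⟩ := hpn
  have hm : 1 ≤ m := by
    rcases Nat.eq_zero_or_pos m with h | h
    · subst h; simp at hn
    · exact h
  rw [Nat.mul_div_cancel_left m hp.pos]
  rw [Nat.mul_comm p m] at hsq hne ⊢
  have h := r0_bound hp5 hm hsq hne
  linarith

end Summit.KontsevichZagierPeriods.Zeta5Search.RVPeriodic
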